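import Summits.ResolutionOfSingularities.ResolutionOfSingularities.Theorems.PurelyInseparableDim4JointForestStep
import HarnessLib

/-!
# Purely inseparable four-folds: the WAITING KID — the strict transform of a waiting member through the blow-up of a
# host member it meets, as a coordinate member of the next stage (brick S3 (c) «joint point∘coordinate chains», part 35 =
# v3-lite (a1) geometric half; cell `res-dim4-pi`)

[OURS · counted 0] (D-0157 DOOR 2; desk WORD #66 (4)(c), #74 (g), #99 (d); frame `PIDim4.TerminationImpliesOrderReduction`,
S3 (c) v3-lite = «waiting members hosted at a root-type member», memo `S3c-V3-DESIGN.md` Addenda 2–4; host item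
stmt-ResolutionOfSingularities-16155, helper). Nothing here proves resolution of singularities in dimension ≥ 4 /
characteristic `p` — NOT here, not anywhere in this programme.

Part 12's `kid_package_of_iso` builds, for a plan entry `(j, b, S″)` with `S ⊆ S″`, the CHILD `c″` of a coordinate member
INSIDE the new exceptional component. A WAITING member `W = V(z, x_i − c_i : i ∈ T)` of the previous stage meeting the host
`V(z, x_S)` (`c|_S = 0`, `S ∖ {j} ⊆ T`, `j ∉ T`) has as strict transform the chart-centre `T(j, c, T)` of the `x_j`-chart,
which is TRANSVERSAL to the exceptional component (memo Addendum 1). This file is part 12 for such an entry, for a host whose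
zigzag chart `Z ←φ— Y —ψ→ 𝔸⁵` sees EVERYTHING (`ψ` onto, `φ(Y)` closed — the ROOT host of v3-lite: `Y = 𝔸⁵`, `φ` the
re-centring automorphism, `ψ = 𝟙`) and whose marked ideal has EMPTY boundary:

* §1 `X_sub_C_mem_B_chart_apply_of_mem_CΛ` — MODEL: the re-centred chart `φ₀ = Spec Θ_c ≫ chartImm_j` maps `V(z, x_T)`
  into the translated coordinate subspace `{x_i = c_i : i ∈ T}` of `𝔸⁵` (`c|_S = 0`, `j ∉ T`; no condition on `z`);
* §2 **`waiting_kid_package_of_iso`** — for a waiting entry `(j, c, T)` (`j ∈ S`, `c_j = 0`, `c|_S = 0`, `S ∖ {j} ⊆ T`,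
  `j ∉ T`): a closed `c″ ⊆ W` and a re-centring `Θ` at `c` reading the model transform as `(z^p + (step p S j c s).F)·𝒪`,
  with the MODEL DESCRIPTION `w ∈ c″ ⟺ ι(ε w) ∈ T_B(j, c, T)`, the PROJECTION `π(c″) ⊆ φ(ψ⁻¹{x_i − c_i ∈ 𝔭 (i ∈ T)})`
  (replacing part 12's `c″ ⊆ π⁻¹(parent)`, false here), `c″ ≠ ∅`, and the coordinate-member data of the forest (regular,
  snc with the new boundary `[E]`, zigzag chart reading the kid state and `𝓘Λ T`, ranges, translated shape `E ↦ (j, 0)`).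
  Closedness of the kid is typ-2's `isClosed_image_CΛ_chart` in its `S.erase j ⊆ S′` form (`…ChartCentreClosed`),
  transported by `zigzag_transport_isClosed` over `D = 𝔸⁵`.

What is NOT here: the algebra of the entry (permissibility / equimultiplicity = part 31), the cover of the order-`p` points
over `W ∖ host` (part 36), the assembled step and the root theorem with waiting members (parts 37–38). AI-produced
formalisation, weaker than expert review. bears_on: LADDER-RESOLUTION:D157-DOOR2 (res-dim4-pi · S3 (c) joint v3-lite).
-/

set_option linter.dupNamespace false -- D-0017: single-problem summit path `Summit.<S>.<S>.…` by design

noncomputable section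

open MvPolynomial Finset CategoryTheory AlgebraicGeometry Opposite TopologicalSpace
open AlgebraicGeometry.Scheme.IdealSheafData (ofIdealTop vanishingIdeal)

namespace Summit.ResolutionOfSingularities.ResolutionOfSingularities.Theorems.PIDim4

open Literature.AlgebraicGeometry.Resolution
open Literature.AlgebraicGeometry.Resolution.Hauser2010
open Literature.AlgebraicGeometry.Resolution.AffinePointBlowup (P A γ coord Wtop ξ)

namespace Equimultiple

/-! ## §1 Model: the re-centred chart maps `V(z, x_T)` into the translated subspace `{x_T = c_T}` -/

section Model

variable {K : Type} [Field K] {Bl : Scheme.{0}} {B : Bl ⟶ P 4 K} {S T : Finset (Fin 4)} {j : Fin 4}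

/-- **Where the re-centred chart maps a transversal coordinate subspace.** For `j ∈ S`, `j ∉ T`, a re-centring `Θ′`
(`Θ′ xᵢ = xᵢ + cᵢ`, constants fixed) with `c_j = 0` and `c|_S = 0`, and `y ∈ V(z, x_T)`: the point
`B(φ₀ y)` of `𝔸⁵` (`φ₀ = Spec Θ′ ≫ chartImm_j`) contains `xᵢ − cᵢ` for every `i ∈ T` (for `i ∈ S ∖ {j}` the chart
substitution gives `x_j · xᵢ`, for `i ∉ S` it gives `xᵢ + cᵢ`). [cite: Hu2025, §5 Prop. 5.3 (the chart substitutions)] -/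
theorem X_sub_C_mem_B_chart_apply_of_mem_CΛ
    (hB : IsBlowup B (AffineCoordBlowup.𝓘Λ 4 K (insert 0 (Fin.succ '' (S : Set (Fin 4))))))
    (hj : j ∈ S) (hjT : j ∉ T) {Θ' : A 4 K →+* A 4 K} {c : Fin 4 → K} (hcj : c j = 0)
    (hcS : ∀ i ∈ S, c i = 0) (hC : ∀ r : K, Θ' (C r) = C r)
    (hs' : ∀ k : Fin 4, Θ' (X k.succ) = X k.succ + C (c k)) {y : P 4 K}
    (hy : y ∈ AffineCoordBlowup.CΛ 4 K (insert 0 (Fin.succ '' (T : Set (Fin 4))))) {i : Fin 4} (hi : i ∈ T) :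
    (X i.succ - C (c i) : A 4 K) ∈
      (B ((Spec.map (CommRingCat.ofHom Θ') ≫
        AffineCoordBlowup.chartImm hB (ChartDictionary.succ_mem_centreVars hj)) y)).asIdeal := by
  rw [← Scheme.Hom.comp_apply, ChartDictionary.chart_comp_eq_specMap hB (ChartDictionary.succ_mem_centreVars hj) Θ']
  have hy' := (AffineCoordBlowup.mem_CΛ_iff' 4 K _ y).mp hy
  have hXi : (X i.succ : A 4 K) ∈ y.asIdeal := hy' i.succ (ChartDictionary.succ_mem_centreVars hi)
  have hij : i ≠ j := fun h => hjT (h ▸ hi)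
  have hσC : ∀ r : K, (Θ'.comp (coordBlowupSubst K (insert 0 (Fin.succ '' (S : Set (Fin 4)))) j.succ).toRingHom) (C r) =
      C r := fun r => by
    rw [RingHom.comp_apply, AlgHom.toRingHom_eq_coe, AlgHom.coe_toRingHom, ← MvPolynomial.algebraMap_eq,
      AlgHom.commutes, MvPolynomial.algebraMap_eq, hC]
  rw [Spec.map_apply, PrimeSpectrum.comap_asIdeal, Ideal.mem_comap, CommRingCat.hom_ofHom, map_sub, hσC,
    RingHom.comp_apply, AlgHom.toRingHom_eq_coe, AlgHom.coe_toRingHom]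
  by_cases hiS : i ∈ S
  · rw [ChartDictionary.clean_subst_X_fibre hcj hs' hiS hij, hcS i hiS, C_0, add_zero, sub_zero]
    exact Ideal.mul_mem_left _ _ hXi
  · rw [ChartDictionary.clean_subst_X_base hs' hiS, add_sub_cancel_right]
    exact hXi

end Model

/-! ## §2 The waiting kid through the shared `ε` -/

section WaitingKid

variable {K : Type} [Field K] {p : ℕ} [hp : Fact p.Prime] [CharP K p] [DecidableEq K]
variable {Z Y W Bl : Scheme.{0}} (φ : Y ⟶ Z) [IsOpenImmersion φ] (ψ : Y ⟶ P 4 K) [IsOpenImmersion ψ]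
  {π : W ⟶ Z} {B : Bl ⟶ P 4 K} {S : Finset (Fin 4)}
  (ε : (π ⁻¹ᵁ φ.opensRange : Scheme.{0}) ≅ (B ⁻¹ᵁ ψ.opensRange : Scheme.{0}))

/-- **THE WAITING KID THROUGH THE SHARED `ε`.** Host: a coordinate member of `(Z, M)` with EMPTY boundary, seen through a
zigzag chart `Z ←φ— Y —ψ→ 𝔸⁵` with `ψ` ONTO and `φ(Y)` CLOSED (root-type host), centre `Zc` reading `𝓘Λ S`, state `s`;
`π : W → Z` any blowing up along `Zc`, `B` any model blowing up of `V(z, x_S)`, `ε` the comparison (square `hsq`, centre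
identity `hC'`, transform transport `hKEY`). For a WAITING ENTRY `(j, c, T)` — `j ∈ S`, `c_j = 0`, `c|_S = 0`,
`S ∖ {j} ⊆ T`, `j ∉ T` — there are a closed `c″ ⊆ W` and a re-centring `Θ` at `c` reading the model transform as
`(z^p + (step p S j c s).F)·𝒪` such that: `w ∈ c″ ⟺ ι(ε w) ∈ T_B(j, c, T)` for every `w` over the chart; every point of
`c″` projects into `φ(ψ⁻¹{x : xᵢ − cᵢ ∈ 𝔭_x (i ∈ T)})`; `c″ ≠ ∅`; and `c″` carries the coordinate-member data of the forest
(regular, snc with `(M.transform π Zc).boundary = [π^* Zc]`, zigzag chart reading the kid state and `𝓘Λ T`, ranges, the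
translated shape sending the exceptional component to `(j, 0)`, injective). This is the STRICT TRANSFORM of the waiting
member `V(z, x_i − c_i : i ∈ T)` of `Z` read on the `x_j`-chart (memo `S3c-V3-DESIGN.md`, Addendum 3).
[cite: BierstoneGrigorievMilmanWlodarczyk2011, Def. 3.1.3 (1)–(2), (4)] [cite: GortzWedhorn2020, Prop. 13.91]
[cite: Hauser2010, §G (transversal strict transforms in the chart expression)] -/
theorem waiting_kid_package_of_iso [IsLocallyNoetherian Z] [IsAlgClosed K] (Zc : Z.IdealSheafData)
    (hπ : IsBlowup π Zc) (hB : IsBlowup B (AffineCoordBlowup.𝓘Λ 4 K (insert 0 (Fin.succ '' (S : Set (Fin 4))))))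
    (hsq : ε.hom ≫ (B ∣_ ψ.opensRange) = (π ∣_ φ.opensRange) ≫ (φ.isoOpensRange.inv ≫ ψ.isoOpensRange.hom))
    (hC' : ((AffineCoordBlowup.𝓘Λ 4 K (insert 0 (Fin.succ '' (S : Set (Fin 4))))).comap ψ.opensRange.ι).comap
        (φ.isoOpensRange.inv ≫ ψ.isoOpensRange.hom) = Zc.comap φ.opensRange.ι)
    (M : MarkedIdeal Z) (hmult : M.mult = p) (hbd : M.boundary = []) (s : State K)
    (hKEY : ((controlledTransform B (AffineCoordBlowup.𝓘Λ 4 K (insert 0 (Fin.succ '' (S : Set (Fin 4)))))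
        (hypSheaf p s.F) p).comap (B ⁻¹ᵁ ψ.opensRange).ι).comap ε.hom =
      (controlledTransform π Zc M.ideal p).comap (π ⁻¹ᵁ φ.opensRange).ι)
    (hperm : (p : ℕ∞) ≤ CentreBlowup.ordAlong S s.F)
    (hsee : (AffineCoordBlowup.CΛ 4 K (insert 0 (Fin.succ '' (S : Set (Fin 4)))) : Set (P 4 K)) ⊆ Set.range ψ)
    (hT : IsClosed (φ '' (ψ ⁻¹' (AffineCoordBlowup.CΛ 4 K (insert 0 (Fin.succ '' (S : Set (Fin 4)))) : Set (P 4 K)))))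
    (hψ : ∀ x : P 4 K, x ∈ Set.range ψ) (hφ : IsClosed (Set.range φ))
    (hsncZ : HasSNCWith M.boundary Zc)
    {j : Fin 4} (hj : j ∈ S) {c : Fin 4 → K} (hcj : c j = 0) (hcS : ∀ i ∈ S, c i = 0)
    {T : Finset (Fin 4)} (hsub : S.erase j ⊆ T) (hjT : j ∉ T) :
    ∃ (c'' : Closeds W) (Θ : A 4 K ≃ₐ[K] A 4 K),
      (∀ i : Fin 4, Θ (X i.succ) = X i.succ + C (c i)) ∧
      (controlledTransform B (AffineCoordBlowup.𝓘Λ 4 K (insert 0 (Fin.succ '' (S : Set (Fin 4))))) (hypSheaf p s.F) p).comap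
          (Spec.map (CommRingCat.ofHom (Θ : A 4 K →+* A 4 K)) ≫
            AffineCoordBlowup.chartImm hB (ChartDictionary.succ_mem_centreVars hj)) =
        hypSheaf p (CentreBlowup.step p S j c s).F ∧
      (∀ (w : W) (hwV : w ∈ π ⁻¹ᵁ φ.opensRange), w ∈ (c'' : Set W) ↔
        ((B ⁻¹ᵁ ψ.opensRange).ι (ε.hom ⟨w, hwV⟩) : Bl) ∈
          (Spec.map (CommRingCat.ofHom (Θ : A 4 K →+* A 4 K)) ≫
            AffineCoordBlowup.chartImm hB (ChartDictionary.succ_mem_centreVars hj)) ''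
            (AffineCoordBlowup.CΛ 4 K (insert 0 (Fin.succ '' (T : Set (Fin 4)))) : Set (P 4 K))) ∧
      (∀ w ∈ (c'' : Set W), π w ∈ φ '' (ψ ⁻¹' {x : P 4 K | ∀ i ∈ T, (X i.succ - C (c i) : A 4 K) ∈ x.asIdeal})) ∧
      (c'' : Set W).Nonempty ∧
      Scheme.IsRegular (vanishingIdeal c'').subscheme ∧
      HasSNCWith (M.transform π Zc).boundary (vanishingIdeal c'') ∧
      ∃ (Y'' : Scheme.{0}) (φ'' : Y'' ⟶ W) (ψ'' : Y'' ⟶ P 4 K) (_ : IsOpenImmersion φ'') (_ : IsOpenImmersion ψ''),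
        (M.transform π Zc).ideal.comap φ'' = (hypSheaf p (CentreBlowup.step p S j c s).F).comap ψ'' ∧
        (vanishingIdeal c'').comap φ'' =
          (AffineCoordBlowup.𝓘Λ 4 K (insert 0 (Fin.succ '' (T : Set (Fin 4))))).comap ψ'' ∧
        (c'' : Set W) ⊆ Set.range φ'' ∧
        (AffineCoordBlowup.CΛ 4 K (insert 0 (Fin.succ '' (T : Set (Fin 4)))) : Set (P 4 K)) ⊆ Set.range ψ'' ∧
        ∃ (idx₂ : W.IdealSheafData → Fin 4) (cst₂ : W.IdealSheafData → K),
          (∀ D₂ ∈ (M.transform π Zc).boundary,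
            ((D₂.support : Set W) ∩ φ'' '' (ψ'' ⁻¹'
              (AffineCoordBlowup.CΛ 4 K (insert 0 (Fin.succ '' (T : Set (Fin 4)))) : Set (P 4 K)))).Nonempty →
            D₂.comap φ'' = (ofIdealTop (Ideal.span {(γ 4 K).symm (X (idx₂ D₂).succ + C (cst₂ D₂))})).comap ψ'' ∧
              (idx₂ D₂ ∈ T → cst₂ D₂ = 0)) ∧
          (∀ D₁ ∈ (M.transform π Zc).boundary, ∀ D₂ ∈ (M.transform π Zc).boundary,
            ((D₁.support : Set W) ∩ φ'' '' (ψ'' ⁻¹'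
              (AffineCoordBlowup.CΛ 4 K (insert 0 (Fin.succ '' (T : Set (Fin 4)))) : Set (P 4 K)))).Nonempty →
            ((D₂.support : Set W) ∩ φ'' '' (ψ'' ⁻¹'
              (AffineCoordBlowup.CΛ 4 K (insert 0 (Fin.succ '' (T : Set (Fin 4)))) : Set (P 4 K)))).Nonempty →
            idx₂ D₁ = idx₂ D₂ → D₁ = D₂) := by
  haveI : PerfectRing K p := PerfectRing.ofSurjective K p fun x => IsAlgClosed.exists_pow_nat_eq x hp.out.pos
  haveI : IsProper π := hπ.isProper
  haveI : IsLocallyNoetherian W := LocallyOfFiniteType.isLocallyNoetherian π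
  haveI : IsProper B := hB.isProper
  haveI : IsLocallyNoetherian Bl := LocallyOfFiniteType.isLocallyNoetherian B
  have hK := hKEY
  obtain ⟨Θ, h, h0, hs, hc⟩ := ChartDictionary.controlledTransform_chart_eq_step p hj hcj s hperm hB
  haveI := isOpenImmersion_specMap_algEquiv Θ
  have hsR : ∀ k : Fin 4, (Θ : A 4 K →+* A 4 K) (X k.succ) = X k.succ + C (c k) := fun k => hs k
  have hCR : ∀ r : K, (Θ : A 4 K →+* A 4 K) (C r) = C r := fun r => Θ.commutes r
  obtain ⟨hread, hexc, -⟩ :=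
    ChartDictionary.zigzag_chart_of_chart φ ψ M hmult s.F (CentreBlowup.step p S j c s).F Zc hsee hT hB ε hsq hC' hK
      hj hcj h0 hs hc
  set φ₀ : P 4 K ⟶ Bl := Spec.map (CommRingCat.ofHom (Θ : A 4 K →+* A 4 K)) ≫
    AffineCoordBlowup.chartImm hB (ChartDictionary.succ_mem_centreVars hj) with hφ₀
  set φ'' := (φ₀ ∣_ (B ⁻¹ᵁ ψ.opensRange)) ≫ ε.inv ≫ (π ⁻¹ᵁ φ.opensRange).ι with hφ''
  set ψ'' := (φ₀ ⁻¹ᵁ (B ⁻¹ᵁ ψ.opensRange)).ι with hψ''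
  haveI : IsOpenImmersion φ₀ := by rw [hφ₀]; infer_instance
  haveI : IsOpenImmersion φ'' := by rw [hφ'']; infer_instance
  -- the new chart sees the whole next centre (the host chart sees everything)
  have hsee'' : (AffineCoordBlowup.CΛ 4 K (insert 0 (Fin.succ '' (T : Set (Fin 4)))) : Set (P 4 K)) ⊆ Set.range ψ'' :=
    ChartDictionary.zigzag_transport_range ψ φ₀ _ fun y _ => hψ _
  -- closedness: typ-2's `erase` criterion on the model, transported over `D = 𝔸⁵`
  have hDc : IsClosed (φ '' (ψ ⁻¹' (Set.univ : Set (P 4 K)))) := by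
    rw [Set.preimage_univ, Set.image_univ]
    exact hφ
  have hclosed'' : IsClosed (φ'' '' (ψ'' ⁻¹'
      (AffineCoordBlowup.CΛ 4 K (insert 0 (Fin.succ '' (T : Set (Fin 4)))) : Set (P 4 K)))) :=
    ChartDictionary.zigzag_transport_isClosed φ ψ ε φ₀ hsq _ Set.univ
      (ChartDictionary.isClosed_image_CΛ_chart hj hcj h0 hs hB hsub) hDc (fun _ _ => Set.mem_univ _)
  set c'' : Closeds W := closureImage φ'' ((((AffineCoordBlowup.𝓘Λ 4 K
    (insert 0 (Fin.succ '' (T : Set (Fin 4))))).comap ψ'').support : Set (φ₀ ⁻¹ᵁ (B ⁻¹ᵁ ψ.opensRange)))) with hc''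
  have hcoe : (c'' : Set W) = φ'' '' (ψ'' ⁻¹'
      (AffineCoordBlowup.CΛ 4 K (insert 0 (Fin.succ '' (T : Set (Fin 4)))) : Set (P 4 K))) := by
    rw [hc'', coe_closureImage, ChartDictionary.coe_support_comap_𝓘Λ ψ'', hclosed''.closure_eq]
  -- the new boundary is the exceptional component alone; its translated shape is `(j, 0)`
  have hbd₂ : (M.transform π Zc).boundary = [Zc.comap π] := by
    change M.boundary.map (strictTransformIdeal π Zc) ++ [Zc.comap π] = _
    rw [hbd, List.map_nil, List.nil_append]
  have hnew : (Zc.comap π).comap φ'' = (ofIdealTop (Ideal.span {(γ 4 K).symm (X j.succ + C (0 : K))})).comap ψ'' := by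
    rw [C_0, add_zero]
    exact hexc
  have hshape₂ : ∀ D₂ ∈ (M.transform π Zc).boundary,
      ((D₂.support : Set W) ∩ φ'' '' (ψ'' ⁻¹'
        (AffineCoordBlowup.CΛ 4 K (insert 0 (Fin.succ '' (T : Set (Fin 4)))) : Set (P 4 K)))).Nonempty →
      D₂.comap φ'' = (ofIdealTop (Ideal.span {(γ 4 K).symm (X ((fun _ => j) D₂).succ + C ((fun _ => (0 : K)) D₂))})).comap
          ψ'' ∧ ((fun _ => j) D₂ ∈ T → (fun _ => (0 : K)) D₂ = 0) := by
    intro D₂ hD₂ _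
    rw [hbd₂, List.mem_singleton] at hD₂
    subst hD₂
    exact ⟨hnew, fun _ => rfl⟩
  have hinj₂ : ∀ D₁ ∈ (M.transform π Zc).boundary, ∀ D₂ ∈ (M.transform π Zc).boundary,
      ((D₁.support : Set W) ∩ φ'' '' (ψ'' ⁻¹'
        (AffineCoordBlowup.CΛ 4 K (insert 0 (Fin.succ '' (T : Set (Fin 4)))) : Set (P 4 K)))).Nonempty →
      ((D₂.support : Set W) ∩ φ'' '' (ψ'' ⁻¹'
        (AffineCoordBlowup.CΛ 4 K (insert 0 (Fin.succ '' (T : Set (Fin 4)))) : Set (P 4 K)))).Nonempty →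
      (fun _ => j) D₁ = (fun _ => j) D₂ → D₁ = D₂ := by
    intro D₁ hD₁ D₂ hD₂ _ _ _
    rw [hbd₂, List.mem_singleton] at hD₁ hD₂
    rw [hD₁, hD₂]
  have hE₂ : HasSNC (M.transform π Zc).boundary := MarkedIdeal.hasSNC_transform_boundary M hsncZ hπ
  have hEc₂ : HasSNCWith ((M.transform π Zc).boundary.map (·.comap φ''))
      ((AffineCoordBlowup.𝓘Λ 4 K (insert 0 (Fin.succ '' (T : Set (Fin 4))))).comap ψ'') :=
    ChartDictionary.hasSNCWith_comap_of_shapeT_zigzag φ'' ψ'' hE₂ (fun _ => j) (fun _ => (0 : K)) hshape₂ hinj₂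
  -- non-emptiness: the origin of the chart lies on the kid
  have hξ : (ξ 4 K) ∈ AffineCoordBlowup.CΛ 4 K (insert 0 (Fin.succ '' (T : Set (Fin 4)))) := by
    rw [AffineCoordBlowup.mem_CΛ_iff']
    intro i _
    exact (mem_originIdeal_iff K (4 + 1)).mpr (constantCoeff_X K i)
  obtain ⟨y₀, hy₀⟩ := hsee'' hξ
  refine ⟨c'', Θ, hs, hc, fun w hwV => ?_, fun w hw => ?_, ⟨φ'' y₀, ?_⟩,
    ChartDictionary.isRegular_globalCentre_zigzag φ'' ψ'' hclosed'',
    ChartDictionary.hasSNCWith_globalCentre_zigzag φ'' ψ'' hclosed'' hE₂ hEc₂, _, φ'', ψ'', inferInstance,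
    inferInstance, hread, by rw [hc'']; exact ChartDictionary.comap_globalCentre_zigzag φ'' ψ'' _,
    by rw [hcoe]; exact Set.image_subset_range _ _, hsee'', fun _ => j, fun _ => 0, hshape₂, hinj₂⟩
  · -- model description of the points of the kid
    rw [hcoe]
    exact mem_image_zigzag_chart_iff φ ψ ε φ₀ _ hwV
  · -- projection: the kid lies over the translated subspace `{x_T = c_T}` seen through `(φ, ψ)`
    rw [hcoe] at hw
    obtain ⟨y, hy, rfl⟩ := hw
    obtain ⟨hπy, hψy⟩ := ChartDictionary.zigzag_transport_π_apply φ ψ ε φ₀ hsq y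
    rw [hπy]
    refine ⟨_, ?_, rfl⟩
    rw [Set.mem_preimage, hψy, Set.mem_setOf_eq]
    intro i hi
    exact X_sub_C_mem_B_chart_apply_of_mem_CΛ hB hj hjT hcj hcS hCR hsR hy hi
  · -- non-emptiness
    rw [hcoe]
    exact ⟨y₀, by rw [Set.mem_preimage, hy₀]; exact hξ, rfl⟩

end WaitingKid

end Equimultiple

end Summit.ResolutionOfSingularities.ResolutionOfSingularities.Theorems.PIDim4

end
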